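import Summits.QuantumFields.QCD.Theorems.RobustYangMillsRG.Negative.HaarPlaquetteDecorrelation
import Summits.QuantumFields.QCD.Theorems.RobustYangMillsRG.Negative.CoarseAnchors
import Literature.MathematicalPhysics.QuantumFieldTheory.ConstructiveQFTWave0WilsonLoopRPProofs
import Summits.QuantumFields.YangMills.Theorems.LangevinControlUVFemtoCurvatureTwoPointStrictRPSiteGeometry
import HarnessLib

/-!
# `RobustYangMillsRG` — negative side, part C₃: the wild blocking map `Bl`

Support for the disproof of the crux `RobustYangMillsRG` (stmt-QuantumFields-14958). On the fine
torus `(ℤ/N)^4` with the crux's anchors `cor : (ℤ/M)^4 → (ℤ/N)^4` we define the blocking map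
`Bl U (y, i) = T_{y,i}(U) · X_{y,i}(U)^{n(U)} · ζ^{j(U)}` where
* `T_{y,i}(U) = lineHolonomy U i (pathLen y i) (cor y)` is the straight transport
  `cor y → cor (y + eᵢ)`;
* `X_{y,i}(U) = lasso y i (2+i) U` and the DIAL `lasso y i (6+i) U` are holonomies of the
  plaquettes in the `(0,1)` plane based at `cor (y+eᵢ) + (1, 1, −1, t)`, transported back to
  `cor (y + eᵢ)` along the lasso path `e → e − e₂ → +t e₃ → +e₀ → +e₁`;
* `(n, j) = decode (Re tr (dial))`, `decode r = unpair (⌊(arccos((r−1)/2))⁻¹⌋₊ − 1)` (mod `3` in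
  the second slot).
This file proves the two structural hypotheses (h1)–(h2) the crux asks of a blocking map: GAUGE
COVARIANCE w.r.t. `g ∘ cor` (`bl_gaugeTransform`) and measurability (`measurable_bl`); locality
and the two "wild" properties (Haar → Haar, zero fibre infimum) follow in parts C₄–C₆. [folklore]
-/

noncomputable section

namespace Summit.QuantumFields.QCD.Theorems.RobustYangMillsRG.Negative

open MeasureTheory Complex Literature.MathematicalPhysics.QuantumFieldTheory
open Literature.MathematicalPhysics.QuantumFieldTheory.WilsonLoopRP (lineHolonomy_add lineHolonomy_congr)
open Summit.QuantumFields.YangMills.Theorems.FemtoCurvatureTwoPoint.StrictRP (plaquetteHolonomy_gaugeTransform')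

/-! ### The decoder -/

/-- The dial decoder: from `r = Re tr h`, `h = e^{iK/(q+1)}`, recover `q` and unpair it into the
exponent `n` and the centre power `j`. [folklore] -/
def decode (r : ℝ) : ℕ × ℕ :=
  ((Nat.unpair (⌊(Real.arccos ((r - 1) / 2))⁻¹⌋₊ - 1)).1,
    (Nat.unpair (⌊(Real.arccos ((r - 1) / 2))⁻¹⌋₊ - 1)).2 % 3)

/-- `decode` inverts the dial reading `1 + 2 cos (1/(q+1))`. [folklore] -/
theorem decode_dial (q : ℕ) :
    decode (1 + 2 * Real.cos ((q : ℝ) + 1)⁻¹) = ((Nat.unpair q).1, (Nat.unpair q).2 % 3) := by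
  have hq : (1 : ℝ) ≤ (q : ℝ) + 1 := by simp
  have hθ0 : 0 ≤ ((q : ℝ) + 1)⁻¹ := by positivity
  have hθπ : ((q : ℝ) + 1)⁻¹ ≤ Real.pi :=
    (inv_le_one_of_one_le₀ hq).trans (by linarith [Real.pi_gt_three])
  have h1 : (1 + 2 * Real.cos ((q : ℝ) + 1)⁻¹ - 1) / 2 = Real.cos ((q : ℝ) + 1)⁻¹ := by ring
  have hfl : ⌊((q : ℝ) + 1)⌋₊ = q + 1 := by exact_mod_cast Nat.floor_natCast (R := ℝ) (q + 1)
  unfold decode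
  simp only [h1, Real.arccos_cos hθ0 hθπ, inv_inv, hfl, Nat.add_sub_cancel]

/-- `decode` is measurable. [folklore] -/
theorem measurable_decode : Measurable decode := by
  have hq : Measurable fun r : ℝ => ⌊(Real.arccos ((r - 1) / 2))⁻¹⌋₊ - 1 :=
    (Nat.measurable_floor.comp ((Real.continuous_arccos.measurable.comp
      ((measurable_id.sub_const 1).div_const 2)).inv)).sub_const 1
  have h1 : Measurable fun q : ℕ => (Nat.unpair q).1 := measurable_from_top
  have h2 : Measurable fun q : ℕ => (Nat.unpair q).2 % 3 := measurable_from_top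
  unfold decode
  exact (h1.comp hq).prodMk (h2.comp hq)

/-! ### Torus holonomy lemmas -/

section Holonomy

variable {d L : ℕ} {G : Type*} [Group G]

/-- Straight transports transform at their end points. [folklore] -/
theorem lineHolonomy_gaugeTransform (g : Site d L → G) (U : GaugeConfig d L G) (k : Fin d) :
    ∀ (n : ℕ) (x : Site d L), lineHolonomy (gaugeTransform g U) k n x =
      g x * lineHolonomy U k n x * (g (x + Pi.single k (n : ZMod L)))⁻¹
  | 0, x => by simp [lineHolonomy]
  | n + 1, x => by
    rw [lineHolonomy, lineHolonomy, lineHolonomy_gaugeTransform g U k n (x.shift k),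
      WilsonLoopRP.shift_add_single]
    simp only [gaugeTransform, Site.shift]
    group

variable [TopologicalSpace G] [IsTopologicalGroup G]

/-- Straight transports are continuous in the links. [folklore] -/
theorem continuous_lineHolonomy' (k : Fin d) :
    ∀ (n : ℕ) (x : Site d L), Continuous fun U : GaugeConfig d L G => lineHolonomy U k n x
  | 0, _ => by simpa [lineHolonomy] using continuous_const
  | n + 1, x => by
    simp only [lineHolonomy]
    exact (continuous_apply _).mul (continuous_lineHolonomy' k n _)

end Holonomy

/-! ### Offsets, lassos and the blocking map -/

variable {N M : ℕ}

/-- The plaquette slot offset `(1, 1, −1, t)` from the end anchor. [folklore] -/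
def oP (t : ℕ) : Fin 4 → ℤ := ![1, 1, -1, (t : ℤ)]

/-- Lasso path offsets: `a₀ = (0,0,−1,0)`, `a₁ = (0,0,−1,t)`, `a₂ = (1,0,−1,t)`. [folklore] -/
def oA0 : Fin 4 → ℤ := ![0, 0, -1, 0]

/-- See `oA0`. [folklore] -/
def oA1 (t : ℕ) : Fin 4 → ℤ := ![0, 0, -1, (t : ℤ)]

/-- See `oA0`. [folklore] -/
def oA2 (t : ℕ) : Fin 4 → ℤ := ![1, 0, -1, (t : ℤ)]

/-- `a₀ + e₂ = 0`. [folklore] -/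
theorem oA0_add_single_two : oA0 + Pi.single 2 1 = (0 : Fin 4 → ℤ) := by
  funext i; fin_cases i <;> simp [oA0]

/-- `a₀ + t e₃ = a₁`. [folklore] -/
theorem oA0_add_single_three (t : ℕ) : oA0 + Pi.single 3 (t : ℤ) = oA1 t := by
  funext i; fin_cases i <;> simp [oA0, oA1]

/-- `a₁ + e₀ = a₂`. [folklore] -/
theorem oA1_add_single_zero (t : ℕ) : oA1 t + Pi.single 0 1 = oA2 t := by
  funext i; fin_cases i <;> simp [oA1, oA2]

/-- `a₂ + e₁ = p`. [folklore] -/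
theorem oA2_add_single_one (t : ℕ) : oA2 t + Pi.single 1 1 = oP t := by
  funext i; fin_cases i <;> simp [oA2, oP]

/-- The lasso transport from the end anchor `e = cor y'` to the plaquette base `e + (1,1,−1,t)`:
backwards along `(e − e₂, 2)`, then `t` steps in direction `3`, one in `0`, one in `1`. [folklore] -/
def lassoTransport (y' : Site 4 M) (t : ℕ) (U : GaugeConfig 4 N SU3) : SU3 :=
  (U (anchor N y' oA0, 2))⁻¹ * lineHolonomy U 3 t (anchor N y' oA0) *
    U (anchor N y' (oA1 t), 0) * U (anchor N y' (oA2 t), 1)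

/-- The lasso holonomy of the `(0,1)` plaquette at `e + (1,1,−1,t)`, based at `e = cor y'`. [folklore] -/
def lasso (y' : Site 4 M) (t : ℕ) (U : GaugeConfig 4 N SU3) : SU3 :=
  lassoTransport y' t U * plaquetteHolonomy U (anchor N y' (oP t)) 0 1 * (lassoTransport y' t U)⁻¹

/-- The decoded exponents of the coarse edge `(y, i)`: read from the dial slot `6 + i`. [folklore] -/
def blExp (y : Site 4 M) (i : Fin 4) (U : GaugeConfig 4 N SU3) : ℕ × ℕ :=
  decode (((lasso (y.shift i) (6 + i) U : SU3) : Matrix (Fin 3) (Fin 3) ℂ).trace.re)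

/-- **The wild blocking map** on one coarse edge. [folklore] -/
def blEdge (y : Site 4 M) (i : Fin 4) (U : GaugeConfig 4 N SU3) : SU3 :=
  lineHolonomy U i (pathLen N y i) (cor N y) *
    (lasso (y.shift i) (2 + i) U ^ (blExp y i U).1 * ζ ^ (blExp y i U).2)

/-- **The wild blocking map** `Bl : (fine links) → (coarse links)`. [folklore] -/
def bl (U : GaugeConfig 4 N SU3) : GaugeConfig 4 M SU3 := fun c => blEdge c.1 c.2 U

/-! ### Gauge covariance (the crux's (h1)) -/

/-- Anchored sites shift by unit vectors. [folklore] -/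
theorem anchor_add_single (y : Site 4 M) (o : Fin 4 → ℤ) (k : Fin 4) (s : ℕ) :
    anchor N y o + Pi.single k (s : ZMod N) = anchor N y (o + Pi.single k (s : ℤ)) := by
  funext c
  simp only [anchor, Pi.add_apply]
  by_cases hc : c = k
  · subst hc; simp [add_assoc]
  · simp [Pi.single_eq_of_ne hc]

/-- The lasso transport transforms at its end points `e = cor y'` and `p = e + (1,1,−1,t)`. [folklore] -/
theorem lassoTransport_gaugeTransform (g : Site 4 N → SU3) (y' : Site 4 M) (t : ℕ)
    (U : GaugeConfig 4 N SU3) :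
    lassoTransport y' t (gaugeTransform g U) =
      g (cor N y') * lassoTransport y' t U * (g (anchor N y' (oP t)))⁻¹ := by
  have h0 : (anchor N y' oA0).shift 2 = cor N y' := by
    rw [anchor_shift, oA0_add_single_two, cor_eq_anchor]
  have h1 : anchor N y' oA0 + Pi.single 3 (t : ZMod N) = anchor N y' (oA1 t) := by
    rw [anchor_add_single, oA0_add_single_three]
  have h2 : (anchor N y' (oA1 t)).shift 0 = anchor N y' (oA2 t) := by
    rw [anchor_shift, oA1_add_single_zero]
  have h3 : (anchor N y' (oA2 t)).shift 1 = anchor N y' (oP t) := by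
    rw [anchor_shift, oA2_add_single_one]
  simp only [lassoTransport, lineHolonomy_gaugeTransform, h1]
  simp only [gaugeTransform, h0, h2, h3, mul_inv_rev, inv_inv]
  group

/-- The lasso holonomy transforms by conjugation at `cor y'`. [folklore] -/
theorem lasso_gaugeTransform (g : Site 4 N → SU3) (y' : Site 4 M) (t : ℕ) (U : GaugeConfig 4 N SU3) :
    lasso y' t (gaugeTransform g U) = g (cor N y') * lasso y' t U * (g (cor N y'))⁻¹ := by
  simp only [lasso, lassoTransport_gaugeTransform, plaquetteHolonomy_gaugeTransform', mul_inv_rev,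
    inv_inv]
  group

/-- The lasso trace, hence the decoded exponents, are gauge invariant. [folklore] -/
theorem blExp_gaugeTransform (g : Site 4 N → SU3) (y : Site 4 M) (i : Fin 4) (U : GaugeConfig 4 N SU3) :
    blExp y i (gaugeTransform g U) = blExp y i U := by
  unfold blExp
  rw [lasso_gaugeTransform, Submonoid.coe_mul, Submonoid.coe_mul, Matrix.trace_mul_cycle,
    ← Submonoid.coe_mul, inv_mul_cancel, OneMemClass.coe_one, Matrix.one_mul]

/-- **(h1) Gauge covariance of the wild blocking map**: `Bl (U^g) = (Bl U)^{g ∘ cor}`. [folklore] -/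
theorem bl_gaugeTransform [NeZero M] (g : Site 4 N → SU3) (U : GaugeConfig 4 N SU3) :
    bl (gaugeTransform g U) = gaugeTransform (g ∘ cor N) (bl (M := M) U) := by
  funext c
  obtain ⟨y, i⟩ := c
  change blEdge y i (gaugeTransform g U) =
    g (cor N y) * blEdge y i U * (g (cor N (y.shift i)))⁻¹
  have hend : cor N y + Pi.single i ((pathLen N y i : ℕ) : ZMod N) = cor N (y.shift i) := by
    rw [cor_shift, cor_eq_anchor, anchor_add_single, zero_add]
  have hζ : ∀ (m : ℕ) (h : SU3), ζ ^ m * h = h * ζ ^ m := fun m h =>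
    ((Subgroup.mem_center_iff.1 (Subgroup.pow_mem _ ζ_mem_center m) h)).symm
  unfold blEdge
  rw [blExp_gaugeTransform, lineHolonomy_gaugeTransform, lasso_gaugeTransform, hend, conj_pow]
  set e := cor N (y.shift i)
  set T := lineHolonomy U i (pathLen N y i) (cor N y)
  set X := lasso (y.shift i) (2 + ↑i) U
  set n := (blExp y i U).1
  set j := (blExp y i U).2
  calc g (cor N y) * T * (g e)⁻¹ * (g e * X ^ n * (g e)⁻¹ * ζ ^ j)
      = g (cor N y) * T * X ^ n * ((g e)⁻¹ * ζ ^ j) := by group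
    _ = g (cor N y) * T * X ^ n * (ζ ^ j * (g e)⁻¹) := by rw [hζ]
    _ = g (cor N y) * (T * (X ^ n * ζ ^ j)) * (g e)⁻¹ := by group

/-! ### Measurability -/

/-- The lasso is continuous in the links. [folklore] -/
theorem continuous_lasso (y' : Site 4 M) (t : ℕ) : Continuous (lasso (N := N) y' t) := by
  unfold lasso lassoTransport
  have hl := continuous_lineHolonomy' (G := SU3) (L := N) (3 : Fin 4) t (anchor N y' oA0)
  have hp := continuous_plaquetteHolonomy (L := N) (anchor N y' (oP t)) (0 : Fin 4) 1
  fun_prop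

/-- The decoded exponents are measurable in the links. [folklore] -/
theorem measurable_blExp [NeZero N] (y : Site 4 M) (i : Fin 4) : Measurable (blExp (N := N) y i) := by
  unfold blExp
  refine measurable_decode.comp (Complex.continuous_re.measurable.comp ?_)
  exact ((continuous_subtype_val.comp (continuous_lasso _ _)).matrix_trace).measurable

/-- `(h, n) ↦ h ^ n` is measurable on `SU(3) × ℕ`. [folklore] -/
theorem measurable_pow_su3 : Measurable fun p : SU3 × ℕ => p.1 ^ p.2 :=
  measurable_from_prod_countable_left fun n => (continuous_pow n).measurable

/-- **Measurability of the wild blocking map.** [folklore] -/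
theorem measurable_bl [NeZero N] : Measurable (bl (N := N) (M := M)) := by
  refine measurable_pi_iff.2 fun c => ?_
  obtain ⟨y, i⟩ := c
  change Measurable fun U => blEdge y i U
  unfold blEdge
  have h1 : Measurable fun U : GaugeConfig 4 N SU3 => lineHolonomy U i (pathLen N y i) (cor N y) :=
    (continuous_lineHolonomy' i _ _).measurable
  have h2 : Measurable fun U : GaugeConfig 4 N SU3 => lasso (y.shift i) (2 + i) U ^ (blExp y i U).1 :=
    measurable_pow_su3.comp ((continuous_lasso _ _).measurable.prodMk ((measurable_blExp y i).fst))
  have h3 : Measurable fun U : GaugeConfig 4 N SU3 => ζ ^ (blExp y i U).2 :=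
    measurable_pow_su3.comp (measurable_const.prodMk ((measurable_blExp y i).snd))
  exact h1.mul (h2.mul h3)

end Summit.QuantumFields.QCD.Theorems.RobustYangMillsRG.Negative

end
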